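import Summits.Ventures.CertifiedManyBodySolver.Downfold.EmeryBoxesInfiniteLayer
import Summits.Ventures.CertifiedManyBodySolver.Downfold.EmeryPictureMap
import HarnessLib

/-!
# The READING dial at the 3BE seam: which Hamiltonian a typed six-box denotes when its `Delta_pd` entry is a
# FLUCTUATION-FORM level («reference fl@(n̄_d, n̄_p)») — the value-free fl-image of a box, its sound Δ-entry
# replacement, the doors under that reading, and the size of the fl-vs-sic gap on `emeryBoxSLCOClass`

Venture CertifiedManyBodySolver, cell `pub/hubbard-downfold` (stage S1 = ROUTER), seat hubbard-downfold-mod-4 (the S1/S2 Emery seam,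
`Downfold/S2SeamEmery`); namespace `Summit.Ventures.CertifiedManyBodySolver.Downfold`. Uses mod-3's `Downfold/EmeryPictureMap`
(p524341; `PictureMap.deltaE Δfl Ud Up V nd np = Δfl − Ud·nd/2 + Up·np/2 − V(4np − 2nd)`, the bare electron-picture charge-transfer
entry of a set printed in fluctuation form at reference occupations `(nd, np)`).

THE QUESTION (cell bus 2026-08-27T10:53–11:02Z; lead rulings R-dt «3BE LEVEL TAGS v2 = (reference, picture)», R-dv «the fl-vs-sic
reading of the printed MACE sets is a LOCATED DISAGREEMENT, decided by mod-3's Δμ job; option β: the seam prints a second, value-free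
bare-e row per member»). S2's decorated model (`emeryEnergyDensity`, p488217) takes BARE electron levels `(ε_d, ε_p)` and adds `U_d`, `U_p`
as operators; `S2SeamEmery` delivers `ε_d = εp + Delta_pd`. If a box's `Delta_pd` members are fluctuation-form levels carrying the target
electrons' own Hartree field (reading «fl», mod-3 A.14), the bare electron entry of the SAME printed Hamiltonian with V at mean field is
`PictureMap.deltaE Δ U_d U_p 0 n̄_d n̄_p = Δ − (U_d n̄_d − U_p n̄_p)/2`, a member-dependent shift of −0.9 … −2.0 eV on the cuprate rows; if the
printed entry already has the self term removed (reading «sic», lit-1 REFVALS-1 §B17 on the MACE cGW-SIC tables), the delivered vector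
is `emeryLineCoords` itself. This file makes option β KERNEL-SIDE and VALUE-FREE: the occupations are INPUTS, no new box number is
typed except an outward-rounded enclosure checked by `norm_num`.

* `flImage nd np p` — the parameter vector with `Delta_pd` replaced by its bare-e image at occupations `(nd, np)` (V at mean field);
  `emeryLineCoords_flImage_two` (the delivered ε_d is `εp + Δ − (U_d nd − U_p np)/2`), `emeryLineCoords_flImage_of_ne_two` (all other
  delivered coordinates unchanged), `emeryLineCoords_sub_flImage_two` (the gap = `(U_d nd − U_p np)/2`);
* `flImage_mem_update` — SOUND Δ-ENTRY REPLACEMENT: if `E` carries `Delta_pd, U_dd, U_pp` entries with `U` lower ends ≥ 0, occupations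
  range over `[ndlo, ndhi] × [nplo, nphi]` (≥ 0), and an entry `eFl` encloses `[Δlo − Udhi·ndhi/2 + Uplo·nplo/2, Δhi − Udlo·ndlo/2 +
  Uphi·nphi/2]` (outward rounding allowed), then `flImage nd np p ∈ Function.update E Delta_pd (some eFl)` for every `p ∈ E` — so EVERY
  door of `S2SeamEmery` / `EmeryMonotoneVertexFloors` applied to the updated box is a door under reading fl (`holdsOn_flImage_of_update`);
* `emeryBoxSLCOClassFl` — the instance for #37's CLASS six-box (`emeryBoxSLCOClass`, p524392: Δ [2.10, 2.62], U_dd [8.88, 9.72], U_pp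
  [5.76, 6.30]; printed GW occupations of the three members n̄_x ∈ [1.433, 1.474], n̄_p ∈ [1.763, 1.783], Morée 2022 Tab. IV): the fl-reading
  Δ entry `slcoClassFlEmery_Delta = [1/100, 47/25]` (outward 2-dp of [0.0138, 1.8739]; the by-member images 1.43 / 0.88 / 0.63 of mod-3's
  SrLaCuO2.md §REDUCTION-A v0 lie inside), `emeryBoxSLCOClassFl_eq_update`, `flImage_mem_emeryBoxSLCOClassFl`, the 64-vertex door under
  reading fl `emeryBoxSLCOClass_energyFloor_fl`, and THE GAP AS A NUMBER: `emeryBoxSLCOClass_readingGap` — on every member and every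
  admissible occupation pair the sic and fl delivered ε_d differ by at least `373/500 = 0.746` eV (and at most `2087/1000 = 2.087`), so the two
  readings are disjoint Hamiltonian boxes here (`emeryBoxSLCOClass_readings_disjoint`: fl ε_d ≤ 1.88 < 2.10 ≤ sic ε_d) — R-dv's «do not bind
  at Lipschitz-2 precision before the verdict», typed.

Everything here is PROVED (0 sorry). HONEST FRAMING: which reading is RIGHT for a given printed table is NOT decided here (R-dv: mod-3's
Δμ-reproduction job decides; both predictions are pre-registered on the bus); this file only makes both readings typed objects with sound
doors, so a certificate can name the reading it used; `V_pd` has no direction in the decorated model (V at mean field is the only option at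
this seam); occupations are the printed reference occupations of the members (inputs, [float]); grade of the fl entry = that of the box
(`extrapolated` for the CLASS box); nothing about any material is certified by this file.
-/

namespace Summit.Ventures.CertifiedManyBodySolver.Downfold

open NonemptyInterval Literature.MathematicalPhysics.QuantumLattice

noncomputable section

/-! ## §1 The fl-image of a parameter vector (value-free: occupations are inputs) -/

/-- **The fl-image of a 3BE parameter vector** at reference electron occupations `(nd, np)`, V at mean field: `Delta_pd` is replaced by
mod-3's bare electron-picture entry `PictureMap.deltaE Δ U_dd U_pp 0 nd np = Δ − U_dd·nd/2 + U_pp·np/2`; every other coordinate is kept.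
[folklore] -/
def flImage (nd np : ℝ) (p : EmeryCoord → ℝ) : EmeryCoord → ℝ :=
  Function.update p .DeltaPd (PictureMap.deltaE (p .DeltaPd) (p .Udd) (p .Upp) 0 nd np)

/-- The replaced coordinate. [folklore] -/
theorem flImage_DeltaPd (nd np : ℝ) (p : EmeryCoord → ℝ) :
    flImage nd np p .DeltaPd = p .DeltaPd - p .Udd * nd / 2 + p .Upp * np / 2 := by
  simp only [flImage, Function.update_self, PictureMap.deltaE]
  ring

/-- Every other coordinate is untouched. [folklore] -/
theorem flImage_of_ne {c : EmeryCoord} (hc : c ≠ .DeltaPd) (nd np : ℝ) (p : EmeryCoord → ℝ) :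
    flImage nd np p c = p c := by
  simp only [flImage, Function.update_of_ne hc]

/-- **The delivered ε_d under reading fl**: `εp + Δ − (U_d nd − U_p np)/2`. [folklore] -/
theorem emeryLineCoords_flImage_two (εp nd np : ℝ) (p : EmeryCoord → ℝ) :
    emeryLineCoords εp (flImage nd np p) 2 = εp + (p .DeltaPd - p .Udd * nd / 2 + p .Upp * np / 2) := by
  have h : emeryLineCoords εp (flImage nd np p) 2 = εp + flImage nd np p .DeltaPd := rfl
  rw [h, flImage_DeltaPd]

/-- **All other delivered coordinates are reading-independent** (`t_pd, t_pp, ε_p, U_d, U_p`). [folklore] -/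
theorem emeryLineCoords_flImage_of_ne_two (εp nd np : ℝ) (p : EmeryCoord → ℝ) :
    emeryLineCoords εp (flImage nd np p) 0 = emeryLineCoords εp p 0 ∧
      emeryLineCoords εp (flImage nd np p) 1 = emeryLineCoords εp p 1 ∧
      emeryLineCoords εp (flImage nd np p) 3 = emeryLineCoords εp p 3 ∧
      emeryLineCoords εp (flImage nd np p) 4 = emeryLineCoords εp p 4 ∧
      emeryLineCoords εp (flImage nd np p) 5 = emeryLineCoords εp p 5 := by
  refine ⟨?_, ?_, ?_, ?_, ?_⟩
  · show flImage nd np p .tpd = p .tpd; exact flImage_of_ne (by decide) nd np p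
  · show flImage nd np p .tpp = p .tpp; exact flImage_of_ne (by decide) nd np p
  · rfl
  · show flImage nd np p .Udd = p .Udd; exact flImage_of_ne (by decide) nd np p
  · show flImage nd np p .Upp = p .Upp; exact flImage_of_ne (by decide) nd np p

/-- **The fl-vs-sic gap on the delivered ε_d** is exactly the self-Hartree difference `(U_d nd − U_p np)/2` (= −t_SIC of the MACE
tables in mod-3's reading). [folklore] -/
theorem emeryLineCoords_sub_flImage_two (εp nd np : ℝ) (p : EmeryCoord → ℝ) :
    emeryLineCoords εp p 2 - emeryLineCoords εp (flImage nd np p) 2 = (p .Udd * nd - p .Upp * np) / 2 := by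
  have h : emeryLineCoords εp p 2 = εp + p .DeltaPd := rfl
  rw [h, emeryLineCoords_flImage_two]
  ring

/-- **Reading «sic» is the identity at this seam** (V at mean field, U-only bare-level model: the printed entry IS the bare-e level,
lit-1 REFVALS-1 §B17) — recorded as the U-free instance of the map: with no self term to remove the fl-image changes nothing. [folklore] -/
theorem flImage_of_free (nd np : ℝ) (p : EmeryCoord → ℝ) (hUd : p .Udd = 0) (hUp : p .Upp = 0) : flImage nd np p = p := by
  funext c
  by_cases hc : c = .DeltaPd
  · subst hc; rw [flImage_DeltaPd, hUd, hUp]; ring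
  · exact flImage_of_ne hc nd np p

/-! ## §2 Sound replacement of the `Delta_pd` entry under reading fl -/

/-- **SOUND Δ-ENTRY REPLACEMENT.** Let `E` carry entries `eD, eUd, eUp` for `Delta_pd, U_dd, U_pp` with `0 ≤ eUd.lo`, `0 ≤ eUp.lo`; let
the reference occupations range over `[ndlo, ndhi] × [nplo, nphi]` with `0 ≤ ndlo`, `0 ≤ nplo`; and let `eFl` be ANY entry whose
enclosure contains `[eD.lo − eUd.hi·ndhi/2 + eUp.lo·nplo/2, eD.hi − eUd.lo·ndlo/2 + eUp.hi·nphi/2]` (outward rounding allowed). Then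
the fl-image of every member of `E` is a member of `E` with its `Delta_pd` entry replaced by `eFl`. [folklore] -/
theorem flImage_mem_update {E : EmeryBox} {eD eUd eUp eFl : Entry} {ndlo ndhi nplo nphi : ℚ}
    (hD : E .DeltaPd = some eD) (hUd : E .Udd = some eUd) (hUp : E .Upp = some eUp)
    (hUd0 : 0 ≤ eUd.encl.fst) (hUp0 : 0 ≤ eUp.encl.fst) (hnd0 : 0 ≤ ndlo) (hnp0 : 0 ≤ nplo)
    (hFlo : eFl.encl.fst ≤ eD.encl.fst - eUd.encl.snd * ndhi / 2 + eUp.encl.fst * nplo / 2)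
    (hFhi : eD.encl.snd - eUd.encl.fst * ndlo / 2 + eUp.encl.snd * nphi / 2 ≤ eFl.encl.snd)
    {nd np : ℝ} (hnd : ((ndlo : ℚ) : ℝ) ≤ nd ∧ nd ≤ ((ndhi : ℚ) : ℝ)) (hnp : ((nplo : ℚ) : ℝ) ≤ np ∧ np ≤ ((nphi : ℚ) : ℝ))
    {p : EmeryCoord → ℝ} (hp : E.Mem p) :
    Box.Mem (Function.update E .DeltaPd (some eFl)) (flImage nd np p) := by
  intro c e hc
  by_cases hcD : c = .DeltaPd
  · subst hcD
    rw [Function.update_self, Option.some.injEq] at hc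
    subst hc
    have hd := mem_ratCast_iff.1 (hp _ _ hD)
    have hud := mem_ratCast_iff.1 (hp _ _ hUd)
    have hup := mem_ratCast_iff.1 (hp _ _ hUp)
    have hUd_nn : (0 : ℝ) ≤ p .Udd := le_trans (by exact_mod_cast hUd0) hud.1
    have hUp_nn : (0 : ℝ) ≤ p .Upp := le_trans (by exact_mod_cast hUp0) hup.1
    have hnd_nn : (0 : ℝ) ≤ nd := le_trans (by exact_mod_cast hnd0) hnd.1
    have hnp_nn : (0 : ℝ) ≤ np := le_trans (by exact_mod_cast hnp0) hnp.1
    have hnplo_nn : (0 : ℝ) ≤ ((nplo : ℚ) : ℝ) := by exact_mod_cast hnp0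
    have hndlo_nn : (0 : ℝ) ≤ ((ndlo : ℚ) : ℝ) := by exact_mod_cast hnd0
    have m1 : p .Udd * nd ≤ ((eUd.encl.snd : ℚ) : ℝ) * ((ndhi : ℚ) : ℝ) :=
      mul_le_mul hud.2 hnd.2 hnd_nn (le_trans hUd_nn hud.2)
    have m2 : ((eUp.encl.fst : ℚ) : ℝ) * ((nplo : ℚ) : ℝ) ≤ p .Upp * np :=
      mul_le_mul hup.1 hnp.1 hnplo_nn hUp_nn
    have m3 : ((eUd.encl.fst : ℚ) : ℝ) * ((ndlo : ℚ) : ℝ) ≤ p .Udd * nd :=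
      mul_le_mul hud.1 hnd.1 hndlo_nn hUd_nn
    have m4 : p .Upp * np ≤ ((eUp.encl.snd : ℚ) : ℝ) * ((nphi : ℚ) : ℝ) :=
      mul_le_mul hup.2 hnp.2 hnp_nn (le_trans hUp_nn hup.2)
    have hlo : ((eFl.encl.fst : ℚ) : ℝ) ≤ ((eD.encl.fst - eUd.encl.snd * ndhi / 2 + eUp.encl.fst * nplo / 2 : ℚ) : ℝ) := by
      exact_mod_cast hFlo
    have hhi : ((eD.encl.snd - eUd.encl.fst * ndlo / 2 + eUp.encl.snd * nphi / 2 : ℚ) : ℝ) ≤ ((eFl.encl.snd : ℚ) : ℝ) := by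
      exact_mod_cast hFhi
    push_cast at hlo hhi
    rw [Entry.Mem, mem_ratCast_iff, flImage_DeltaPd]
    constructor
    · linarith [hd.1]
    · linarith [hd.2]
  · rw [Function.update_of_ne hcD] at hc
    rw [flImage_of_ne hcD]
    exact hp c e hc

/-- **Every word on the Δ-replaced box is a word under reading fl on the original box.** [folklore] -/
theorem holdsOn_flImage_of_update {E : EmeryBox} {eD eUd eUp eFl : Entry} {ndlo ndhi nplo nphi : ℚ}
    (hD : E .DeltaPd = some eD) (hUd : E .Udd = some eUd) (hUp : E .Upp = some eUp)
    (hUd0 : 0 ≤ eUd.encl.fst) (hUp0 : 0 ≤ eUp.encl.fst) (hnd0 : 0 ≤ ndlo) (hnp0 : 0 ≤ nplo)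
    (hFlo : eFl.encl.fst ≤ eD.encl.fst - eUd.encl.snd * ndhi / 2 + eUp.encl.fst * nplo / 2)
    (hFhi : eD.encl.snd - eUd.encl.fst * ndlo / 2 + eUp.encl.snd * nphi / 2 ≤ eFl.encl.snd)
    {nd np : ℝ} (hnd : ((ndlo : ℚ) : ℝ) ≤ nd ∧ nd ≤ ((ndhi : ℚ) : ℝ)) (hnp : ((nplo : ℚ) : ℝ) ≤ np ∧ np ≤ ((nphi : ℚ) : ℝ))
    {W : (EmeryCoord → ℝ) → Prop} (hW : HoldsOn W (Function.update E .DeltaPd (some eFl))) :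
    HoldsOn (fun p => W (flImage nd np p)) E :=
  fun _ hp => hW _ (flImage_mem_update hD hUd hUp hUd0 hUp0 hnd0 hnp0 hFlo hFhi hnd hnp hp)

/-! ## §3 The instance: `emeryBoxSLCOClass` (#37, CLASS cGW-SIC six-box) under reading fl -/

/-- **The fl-reading `Delta_pd` entry of #37's CLASS six-box**: `[1/100, 47/25] = [0.01, 1.88]` eV = outward 2-dp rounding of
`[2.10 − 9.72·1.474/2 + 5.76·1.763/2, 2.62 − 8.88·1.433/2 + 6.30·1.783/2] = [0.0138, 1.8739]` (box Δ [2.10, 2.62], U_dd [8.88, 9.72],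
U_pp [5.76, 6.30]; printed GW occupations of the three members n̄_x 1.433 / 1.454 / 1.474, n̄_p 1.783 / 1.773 / 1.763, Morée 2022 Tab. IV).
The by-member images 1.43 (AE) / 0.88 (PP) / 0.63 (PP δ 0.1) of SrLaCuO2.md §REDUCTION-A v0 (mod-3) lie inside; the interval is wider
than their hull [0.63, 1.43] because the box decorrelates Δ, U and n̄ (sound for the whole product box). Reading fl is ONE SIDE of a
located disagreement (R-dv). [folklore] -/
def slcoClassFlEmery_Delta : Entry := Entry.ofEnds (1/100) (47/25) (by norm_num) .extrapolated

/-- **#37's CLASS six-box under reading fl** (Δ entry replaced; all other entries as `emeryBoxSLCOClass`). [folklore] -/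
def emeryBoxSLCOClassFl : EmeryBox := fun c =>
  match c with
  | .DeltaPd => some slcoClassFlEmery_Delta
  | .tpd => some slcoClassEmery_tpd
  | .tpp => some slcoClassEmery_tpp
  | .tppP => none
  | .Udd => some slcoClassEmery_Udd
  | .Upp => some slcoClassEmery_Upp
  | .Vpd => some slcoClassEmery_Vpd
  | .nHoles => some slcoEmery_nH

/-- The fl box IS the Δ-update of the sic box. [folklore] -/
theorem emeryBoxSLCOClassFl_eq_update :
    emeryBoxSLCOClassFl = Function.update emeryBoxSLCOClass .DeltaPd (some slcoClassFlEmery_Delta) := by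
  funext c
  cases c <;> simp [emeryBoxSLCOClassFl, emeryBoxSLCOClass, Function.update]

/-- **The fl-image of every member of `emeryBoxSLCOClass` lies in `emeryBoxSLCOClassFl`** for every occupation pair in the members'
printed range `n̄_x ∈ [1.433, 1.474]`, `n̄_p ∈ [1.763, 1.783]`. [folklore] -/
theorem flImage_mem_emeryBoxSLCOClassFl {nd np : ℝ}
    (hnd : (((1433/1000 : ℚ)) : ℝ) ≤ nd ∧ nd ≤ (((737/500 : ℚ)) : ℝ))
    (hnp : (((1763/1000 : ℚ)) : ℝ) ≤ np ∧ np ≤ (((1783/1000 : ℚ)) : ℝ))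
    {p : EmeryCoord → ℝ} (hp : emeryBoxSLCOClass.Mem p) : emeryBoxSLCOClassFl.Mem (flImage nd np p) := by
  rw [emeryBoxSLCOClassFl_eq_update]
  exact flImage_mem_update (E := emeryBoxSLCOClass) (eD := slcoClassEmery_Delta) (eUd := slcoClassEmery_Udd)
    (eUp := slcoClassEmery_Upp) (eFl := slcoClassFlEmery_Delta) rfl rfl rfl
    (by rw [slcoClassEmery_Udd, Entry.encl_ofEnds_fst]; norm_num)
    (by rw [slcoClassEmery_Upp, Entry.encl_ofEnds_fst]; norm_num)
    (by norm_num) (by norm_num)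
    (by rw [slcoClassFlEmery_Delta, slcoClassEmery_Delta, slcoClassEmery_Udd, slcoClassEmery_Upp, Entry.encl_ofEnds_fst,
          Entry.encl_ofEnds_fst, Entry.encl_ofEnds_snd, Entry.encl_ofEnds_fst]; norm_num)
    (by rw [slcoClassFlEmery_Delta, slcoClassEmery_Delta, slcoClassEmery_Udd, slcoClassEmery_Upp, Entry.encl_ofEnds_snd,
          Entry.encl_ofEnds_snd, Entry.encl_ofEnds_fst, Entry.encl_ofEnds_snd]; norm_num)
    hnd hnp hp

/-- Lower corner of the fl-reading delivered six-box of #37's CLASS box at `εp = 0`: `(129/100, 37/50, 1/100, 0, 222/25, 144/25)`. [folklore] -/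
theorem slcoClassFl_emeryLo : emeryLo 0 slcoClassEmery_tpd slcoClassEmery_tpp slcoClassFlEmery_Delta slcoClassEmery_Udd
    slcoClassEmery_Upp = ![129/100, 37/50, 1/100, 0, 222/25, 144/25] := by
  ext i; fin_cases i <;>
    simp [emeryLo, slcoClassEmery_tpd, slcoClassEmery_tpp, slcoClassFlEmery_Delta, slcoClassEmery_Udd, slcoClassEmery_Upp]

/-- Upper corner of the fl-reading delivered six-box: `(34/25, 41/50, 47/25, 0, 243/25, 63/10)`. [folklore] -/
theorem slcoClassFl_emeryHi : emeryHi 0 slcoClassEmery_tpd slcoClassEmery_tpp slcoClassFlEmery_Delta slcoClassEmery_Udd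
    slcoClassEmery_Upp = ![34/25, 41/50, 47/25, 0, 243/25, 63/10] := by
  ext i; fin_cases i <;>
    simp [emeryHi, slcoClassEmery_tpd, slcoClassEmery_tpp, slcoClassFlEmery_Delta, slcoClassEmery_Udd, slcoClassEmery_Upp]

/-- **Vertex-certified floor UNDER READING fl on `emeryBoxSLCOClass`**: a floor certified at the 64 vertices of the fl six-box
`[(129/100, 37/50, 1/100, 0, 222/25, 144/25), (34/25, 41/50, 47/25, 0, 243/25, 63/10)]` holds, for every member `p` of the CLASS box and
every occupation pair in the printed range, at the fl-delivered vector `emeryLineCoords 0 (flImage nd np p)`. [cite: Israel1979, Thm. I.3.4] -/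
theorem emeryBoxSLCOClass_energyFloor_fl (s : Fin 4 → ℝ) (ρ : ℝ) {m : ℝ}
    (hm : ∀ v ∈ Fintype.piFinset (fun i => ({(![129/100, 37/50, 1/100, 0, 222/25, 144/25] : Fin 6 → ℝ) i,
        (![34/25, 41/50, 47/25, 0, 243/25, 63/10] : Fin 6 → ℝ) i} : Finset ℝ)), m ≤ emeryEnergyDensity (emeryLine s v) ρ)
    {nd np : ℝ} (hnd : (((1433/1000 : ℚ)) : ℝ) ≤ nd ∧ nd ≤ (((737/500 : ℚ)) : ℝ))
    (hnp : (((1763/1000 : ℚ)) : ℝ) ≤ np ∧ np ≤ (((1783/1000 : ℚ)) : ℝ)) :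
    HoldsOn (fun p : EmeryCoord → ℝ => m ≤ emeryEnergyDensity (emeryLine s (emeryLineCoords 0 (flImage nd np p))) ρ)
      emeryBoxSLCOClass := by
  have h := holdsOn_emeryEnergyFloor (E := emeryBoxSLCOClassFl) (εp := 0) (eA := slcoClassEmery_tpd) (eB := slcoClassEmery_tpp)
    (eD := slcoClassFlEmery_Delta) (eUd := slcoClassEmery_Udd) (eUp := slcoClassEmery_Upp) rfl rfl rfl rfl rfl s ρ (m := m)
    (by rw [slcoClassFl_emeryLo, slcoClassFl_emeryHi]; exact hm)
  intro p hp
  have h' := h _ (flImage_mem_emeryBoxSLCOClassFl hnd hnp hp)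
  simpa using h'

/-- **THE READING GAP AS A NUMBER on #37's CLASS box**: for every member and every admissible occupation pair, the sic-delivered ε_d
exceeds the fl-delivered ε_d by at least `373/500 = 0.746` eV and at most `2087/1000 = 2.087` eV (`(U_d n̄_d − U_p n̄_p)/2` over the box).
At the seam's Lipschitz constant 2 per unit of ε_d this is a 1.49–4.17 eV/site displacement bound: the two readings are different Hamiltonians
at any precision S2 certifies — R-dv's «do not bind at Lipschitz-2 precision before the verdict». [folklore] -/
theorem emeryBoxSLCOClass_readingGap {nd np : ℝ}
    (hnd : (((1433/1000 : ℚ)) : ℝ) ≤ nd ∧ nd ≤ (((737/500 : ℚ)) : ℝ))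
    (hnp : (((1763/1000 : ℚ)) : ℝ) ≤ np ∧ np ≤ (((1783/1000 : ℚ)) : ℝ))
    {p : EmeryCoord → ℝ} (hp : emeryBoxSLCOClass.Mem p) (εp : ℝ) :
    (((373/500 : ℚ)) : ℝ) ≤ emeryLineCoords εp p 2 - emeryLineCoords εp (flImage nd np p) 2 ∧
      emeryLineCoords εp p 2 - emeryLineCoords εp (flImage nd np p) 2 ≤ (((2087/1000 : ℚ)) : ℝ) := by
  rw [emeryLineCoords_sub_flImage_two]
  rw [emeryBoxSLCOClass_mem_iff] at hp
  obtain ⟨-, -, -, -, -, -, a4, b4, a5, b5, -⟩ := hp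
  obtain ⟨c1, c2⟩ := hnd
  obtain ⟨d1, d2⟩ := hnp
  push_cast at a4 b4 a5 b5 c1 c2 d1 d2 ⊢
  have hUd_nn : (0 : ℝ) ≤ p .Udd := by linarith
  have hUp_nn : (0 : ℝ) ≤ p .Upp := by linarith
  have hnd_nn : (0 : ℝ) ≤ nd := by linarith
  have hnp_nn : (0 : ℝ) ≤ np := by linarith
  have m3 : (222/25 : ℝ) * (1433/1000) ≤ p .Udd * nd := mul_le_mul a4 c1 (by norm_num) hUd_nn
  have m1 : p .Udd * nd ≤ (243/25 : ℝ) * (737/500) := mul_le_mul b4 c2 hnd_nn (by linarith)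
  have m2 : (144/25 : ℝ) * (1763/1000) ≤ p .Upp * np := mul_le_mul a5 d1 (by norm_num) hUp_nn
  have m4 : p .Upp * np ≤ (63/10 : ℝ) * (1783/1000) := mul_le_mul b5 d2 hnp_nn (by linarith)
  constructor
  · nlinarith [m3, m4]
  · nlinarith [m1, m2]

/-- **The two readings are DISJOINT boxes on #37**: the fl-delivered ε_d is at most `1.88 + εp` while the sic-delivered ε_d is at least
`2.10 + εp` — no certificate on one reading's box is a statement about the other's. [folklore] -/
theorem emeryBoxSLCOClass_readings_disjoint {nd np : ℝ}
    (hnd : (((1433/1000 : ℚ)) : ℝ) ≤ nd ∧ nd ≤ (((737/500 : ℚ)) : ℝ))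
    (hnp : (((1763/1000 : ℚ)) : ℝ) ≤ np ∧ np ≤ (((1783/1000 : ℚ)) : ℝ))
    {p : EmeryCoord → ℝ} (hp : emeryBoxSLCOClass.Mem p) (εp : ℝ) :
    emeryLineCoords εp (flImage nd np p) 2 ≤ εp + (((47/25 : ℚ)) : ℝ) ∧ εp + (((21/10 : ℚ)) : ℝ) ≤ emeryLineCoords εp p 2 := by
  have hfl := flImage_mem_emeryBoxSLCOClassFl hnd hnp hp
  have hD : (((1/100 : ℚ)) : ℝ) ≤ flImage nd np p .DeltaPd ∧ flImage nd np p .DeltaPd ≤ (((47/25 : ℚ)) : ℝ) :=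
    (Entry.mem_ofEnds_iff _ _ _ _ _).1 (hfl .DeltaPd slcoClassFlEmery_Delta rfl)
  rw [emeryBoxSLCOClass_mem_iff] at hp
  obtain ⟨a0, -, -⟩ := hp
  have e1 : emeryLineCoords εp (flImage nd np p) 2 = εp + flImage nd np p .DeltaPd := rfl
  have e2 : emeryLineCoords εp p 2 = εp + p .DeltaPd := rfl
  rw [e1, e2]
  exact ⟨by linarith [hD.2], by linarith [a0]⟩

end

end Summit.Ventures.CertifiedManyBodySolver.Downfold

/-! ## §4 Which way the fl image moves `Delta_pd`: the SCHOOL RATIO criterion (appended 2026-08-27 by hubbard-downfold-mod-4 g9)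

Cell ruling R-B18 (c) records «INFL-U-SCHOOL» as context: at fixed DFT one-body rows the U SCHOOL alone moves La₂CuO₄'s bare d level by
6.7 eV across the four named `(U_dd, U_pp)` pairs (router/EMERY-LINE-ROWS v2.2). The elementary reason, typed: the shift
`Δ^e − Δ = (U_pp·n̄_p − U_dd·n̄_d)/2` is non-negative EXACTLY when `U_dd·n̄_d ≤ U_pp·n̄_p`, i.e. when the school's ratio `U_pp/U_dd` is at least
the occupation ratio `n̄_d/n̄_p` (≈ 0.70–0.86 on every cuprate TB-occ range of record) — the static-cRPA (K) school (0.78–0.94) sits above it,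
cLDA (0.38) / Kung (0.48) / Werner (0.66) / MACE (0.60–0.63) below. -/

namespace Summit.Ventures.CertifiedManyBodySolver.Downfold

noncomputable section

/-- The fl shift of `Delta_pd` in closed form: `Δ^e − Δ = (U_pp·n̄_p − U_dd·n̄_d)/2`. [folklore] -/
theorem flImage_DeltaPd_sub (nd np : ℝ) (p : EmeryCoord → ℝ) :
    flImage nd np p .DeltaPd - p .DeltaPd = (p .Upp * np - p .Udd * nd) / 2 := by
  rw [flImage_DeltaPd]; ring

/-- **School-ratio criterion**: the bare-electron level lies at or above the printed one iff `U_dd·n̄_d ≤ U_pp·n̄_p`. [folklore] -/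
theorem le_flImage_DeltaPd_iff (nd np : ℝ) (p : EmeryCoord → ℝ) :
    p .DeltaPd ≤ flImage nd np p .DeltaPd ↔ p .Udd * nd ≤ p .Upp * np := by
  rw [flImage_DeltaPd]
  constructor <;> intro h <;> linarith

/-- The same criterion as a RATIO test (positive `U_dd` and `n̄_p`): `n̄_d/n̄_p ≤ U_pp/U_dd ⇒ Δ ≤ Δ^e`. [folklore] -/
theorem le_flImage_DeltaPd_of_ratio {nd np : ℝ} {p : EmeryCoord → ℝ} (hUd : 0 < p .Udd) (hnp : 0 < np)
    (h : nd / np ≤ p .Upp / p .Udd) : p .DeltaPd ≤ flImage nd np p .DeltaPd := by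
  rw [le_flImage_DeltaPd_iff]
  rw [div_le_div_iff₀ hnp hUd] at h
  linarith

/-- And conversely: `U_pp/U_dd < n̄_d/n̄_p ⇒ Δ^e < Δ` (the cLDA / Kung / Werner / MACE side). [folklore] -/
theorem flImage_DeltaPd_lt_of_ratio {nd np : ℝ} {p : EmeryCoord → ℝ} (hUd : 0 < p .Udd) (hnp : 0 < np)
    (h : p .Upp / p .Udd < nd / np) : flImage nd np p .DeltaPd < p .DeltaPd := by
  rw [flImage_DeltaPd]
  rw [div_lt_div_iff₀ hUd hnp] at h
  linarith

end

end Summit.Ventures.CertifiedManyBodySolver.Downfold
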